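import Summits.QuantumFields.YangMills.Theorems.ColdStartUniversalityUniformColdStartMixingChiSquareEntropy
import HarnessLib

/-!
# Route `ColdStartUniversality`, crux K_A1 (stmt-QuantumFields-24809), `L²` twin of line «cold_entropy»: the DUAL FORM of the χ²
# budget IS the χ² budget — `(∫G dν − ∫G dμ)² ≤ X₀ Var_μ(G) ∀ |G| ≤ 1  ⟺  ν ≪ μ ∧ χ²(ν‖μ) ≤ X₀`

Helper file (seat `ym-line-csu-p1`, g16; `--supports stmt-QuantumFields-24809`).  `…ChiSquareEntropy` proved «dual ⇒ `ν ≪ μ` and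
`∫ (dν/dμ − 1)² dμ ≤ X₀`»; this file proves the converse (Cauchy–Schwarz against the centred observable), so that hypothesis (H2) of
`chiSquareStep` is literally «`χ²(law U(s₀/ε_K) ‖ μ_K) ≤ X₀` uniformly in `K`», justifying its name:

* `sq_integral_mul_le_of_sq_integrable` — Cauchy–Schwarz `(∫ f g dμ)² ≤ ∫ f² dμ · ∫ g² dμ` for `f ∈ L¹ ∩ L²` and bounded measurable
  `g` (quadratic-discriminant proof, no `Lp` machinery);
* ★ `dual_sq_le_of_chiSq_le` — `ν ≪ μ`, `∫⁻ (dν/dμ − 1)² dμ ≤ X₀` ⇒ the dual bound for every bounded measurable `G`;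
* ★ `dual_sq_le_iff_chiSq_le` — the equivalence (with `…ChiSquareEntropy`).

THEOREMS ONLY, no definition, no sorry; abstract measure theory (any measurable space).  HONEST FRAMING: bookkeeping for the `L²` twin;
nothing about the dynamics, nothing K-uniform; the Yang–Mills mass gap is NOT proved.
-/

set_option autoImplicit false

noncomputable section

namespace Summit.QuantumFields.YangMills.Theorems.ColdStartUniversality

open MeasureTheory ProbabilityTheory InformationTheory
open scoped NNReal ENNReal

variable {α : Type*} [MeasurableSpace α]

/-- **Cauchy–Schwarz** `(∫ f g dμ)² ≤ (∫ f² dμ)(∫ g² dμ)` for an integrable `f` with integrable square and a bounded measurable `g`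
(finite measure): the quadratic `λ ↦ ∫ (f − λ g)² ≥ 0`. [folklore] -/
theorem sq_integral_mul_le_of_sq_integrable (μ : Measure α) [IsFiniteMeasure μ] {f g : α → ℝ}
    (hfi : Integrable f μ) (hf2 : Integrable (fun x => (f x) ^ 2) μ) (hgm : Measurable g) {C : ℝ} (hgC : ∀ x, |g x| ≤ C) :
    (∫ x, f x * g x ∂μ) ^ 2 ≤ (∫ x, (f x) ^ 2 ∂μ) * ∫ x, (g x) ^ 2 ∂μ := by
  have hg2 : Integrable (fun x => (g x) ^ 2) μ :=
    (integrable_const (C ^ 2)).mono' (hgm.pow_const 2).aestronglyMeasurable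
      (ae_of_all _ fun x => by rw [Real.norm_eq_abs, abs_pow]; exact pow_le_pow_left₀ (abs_nonneg _) (hgC x) 2)
  have hfg : Integrable (fun x => f x * g x) μ :=
    hfi.mul_bdd hgm.aestronglyMeasurable (ae_of_all _ fun x => by rw [Real.norm_eq_abs]; exact hgC x)
  set A : ℝ := ∫ x, (f x) ^ 2 ∂μ with hA
  set B : ℝ := ∫ x, (g x) ^ 2 ∂μ with hB
  set P : ℝ := ∫ x, f x * g x ∂μ with hP
  have hA0 : 0 ≤ A := integral_nonneg fun x => sq_nonneg _
  have hB0 : 0 ≤ B := integral_nonneg fun x => sq_nonneg _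
  have hquad : ∀ l : ℝ, 0 ≤ A - 2 * l * P + l ^ 2 * B := by
    intro l
    have h0 : 0 ≤ ∫ x, (f x - l * g x) ^ 2 ∂μ := integral_nonneg fun x => sq_nonneg _
    have hexp : ∫ x, (f x - l * g x) ^ 2 ∂μ = A - 2 * l * P + l ^ 2 * B := by
      have e : ∀ x, (f x - l * g x) ^ 2 = (f x) ^ 2 - 2 * l * (f x * g x) + l ^ 2 * (g x) ^ 2 := fun x => by ring
      simp_rw [e]
      have i0 : Integrable (fun x => 2 * l * (f x * g x)) μ := hfg.const_mul _
      have i1 : Integrable (fun x => (f x) ^ 2 - 2 * l * (f x * g x)) μ := hf2.sub i0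
      have i2 : Integrable (fun x => l ^ 2 * (g x) ^ 2) μ := hg2.const_mul _
      rw [integral_add i1 i2, integral_sub hf2 i0, integral_const_mul, integral_const_mul]
    linarith
  rcases hB0.eq_or_lt with hBz | hBpos
  · -- `B = 0`: the quadratic is affine, so `P = 0`
    have hP0 : P = 0 := by
      by_contra hne
      have h1 := hquad ((A + 1) / (2 * P))
      rw [← hBz, mul_zero, add_zero] at h1
      have : 2 * ((A + 1) / (2 * P)) * P = A + 1 := by field_simp
      linarith
    rw [hP0, ← hBz]; simp
  · have h1 := hquad (P / B)
    have e : A - 2 * (P / B) * P + (P / B) ^ 2 * B = A - P ^ 2 / B := by field_simp; ring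
    rw [e] at h1
    have h2 : P ^ 2 / B ≤ A := by linarith
    rwa [div_le_iff₀ hBpos] at h2

/-- ★ **χ² bound ⇒ dual bound**: for probability measures `ν ≪ μ` with `∫⁻ (dν/dμ − 1)² dμ ≤ X₀`, every bounded measurable `G`
satisfies `(∫ G dν − ∫ G dμ)² ≤ X₀ ∫ (G − μG)² dμ` (write `∫G dν − ∫G dμ = ∫ (h − 1)(G − μG) dμ` and Cauchy–Schwarz). [folklore] -/
theorem dual_sq_le_of_chiSq_le {ν μ : Measure α} [IsProbabilityMeasure ν] [IsProbabilityMeasure μ] (hac : ν ≪ μ)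
    {X₀ : ℝ} (hX₀ : 0 ≤ X₀)
    (hchi : ∫⁻ x, ENNReal.ofReal (((ν.rnDeriv μ x).toReal - 1) ^ 2) ∂μ ≤ ENNReal.ofReal X₀)
    {G : α → ℝ} (hG : Measurable G) {M : ℝ} (hM : ∀ x, |G x| ≤ M) :
    ((∫ x, G x ∂ν) - ∫ x, G x ∂μ) ^ 2 ≤ X₀ * ∫ x, (G x - ∫ z, G z ∂μ) ^ 2 ∂μ := by
  set p : α → ℝ := fun x => (ν.rnDeriv μ x).toReal with hp
  have hpm : Measurable p := (ν.measurable_rnDeriv μ).ennreal_toReal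
  have hpi : Integrable p μ := Measure.integrable_toReal_rnDeriv
  have hp1 : ∫ x, p x ∂μ = 1 := by
    rw [hp]
    show ∫ x, (ν.rnDeriv μ x).toReal ∂μ = 1
    rw [Measure.integral_toReal_rnDeriv hac]; simp
  -- `f = p − 1 ∈ L¹ ∩ L²` with `∫ f² ≤ X₀`
  have hfi : Integrable (fun x => p x - 1) μ := hpi.sub (integrable_const 1)
  have hfm : Measurable fun x => p x - 1 := hpm.sub measurable_const
  have hlt : ∫⁻ x, ENNReal.ofReal ((p x - 1) ^ 2) ∂μ < ∞ := lt_of_le_of_lt hchi ENNReal.ofReal_lt_top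
  have hf2 : Integrable (fun x => (p x - 1) ^ 2) μ := by
    refine ⟨(hfm.pow_const 2).aestronglyMeasurable, ?_⟩
    rw [hasFiniteIntegral_iff_ofReal (ae_of_all _ fun x => sq_nonneg (p x - 1))]
    exact hlt
  have hf2le : ∫ x, (p x - 1) ^ 2 ∂μ ≤ X₀ := by
    have e : ENNReal.ofReal (∫ x, (p x - 1) ^ 2 ∂μ) = ∫⁻ x, ENNReal.ofReal ((p x - 1) ^ 2) ∂μ :=
      ofReal_integral_eq_lintegral_ofReal hf2 (ae_of_all _ fun x => sq_nonneg _)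
    have h := e.trans_le hchi
    exact (ENNReal.ofReal_le_ofReal_iff hX₀).1 h
  -- the centred observable and the identity `∫G dν − ∫G dμ = ∫ (p − 1)(G − m) dμ`
  set m : ℝ := ∫ z, G z ∂μ with hm
  have hGi : Integrable G μ := (integrable_const M).mono' hG.aestronglyMeasurable
    (ae_of_all _ fun x => by rw [Real.norm_eq_abs]; exact hM x)
  have hmb : |m| ≤ M := by
    have h1 : |∫ z, G z ∂μ| ≤ ∫ z, |G z| ∂μ := abs_integral_le_integral_abs
    have h2 : ∫ z, |G z| ∂μ ≤ ∫ _z, M ∂μ := integral_mono hGi.abs (integrable_const M) fun z => hM z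
    simp at h2
    exact h1.trans h2
  have hGc : Measurable fun x => G x - m := hG.sub measurable_const
  have hGcb : ∀ x, |G x - m| ≤ M + M := fun x => (abs_sub _ _).trans (add_le_add (hM x) hmb)
  have hνG : ∫ x, G x ∂ν = ∫ x, p x * G x ∂μ := (integral_toReal_rnDeriv_mul hac).symm
  have hpG : Integrable (fun x => p x * G x) μ :=
    hpi.mul_bdd hG.aestronglyMeasurable (ae_of_all _ fun x => by rw [Real.norm_eq_abs]; exact hM x)
  have hid : (∫ x, G x ∂ν) - ∫ x, G x ∂μ = ∫ x, (p x - 1) * (G x - m) ∂μ := by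
    have e : ∀ x, (p x - 1) * (G x - m) = p x * G x - G x - m * p x + m := fun x => by ring
    simp_rw [e]
    have i3 : Integrable (fun x => m * p x) μ := hpi.const_mul m
    have i2 : Integrable (fun x => p x * G x - G x) μ := hpG.sub hGi
    have i1 : Integrable (fun x => p x * G x - G x - m * p x) μ := i2.sub i3
    rw [integral_add i1 (integrable_const m), integral_sub i2 i3, integral_sub hpG hGi, integral_const_mul, hp1, hνG]
    simp [hm]
  rw [hid]
  calc (∫ x, (p x - 1) * (G x - m) ∂μ) ^ 2 ≤ (∫ x, (p x - 1) ^ 2 ∂μ) * ∫ x, (G x - m) ^ 2 ∂μ :=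
        sq_integral_mul_le_of_sq_integrable μ hfi hf2 hGc hGcb
    _ ≤ X₀ * ∫ x, (G x - m) ^ 2 ∂μ := mul_le_mul_of_nonneg_right hf2le (integral_nonneg fun x => sq_nonneg _)

/-- ★ **The dual form of the χ² budget is the χ² budget**: for probability measures and `X₀ ≥ 0`,
`(∀ measurable |G| ≤ 1, (∫G dν − ∫G dμ)² ≤ X₀ Var_μ(G)) ↔ (ν ≪ μ ∧ ∫⁻ (dν/dμ − 1)² dμ ≤ X₀)`. [folklore] -/
theorem dual_sq_le_iff_chiSq_le {ν μ : Measure α} [IsProbabilityMeasure ν] [IsProbabilityMeasure μ] {X₀ : ℝ} (hX₀ : 0 ≤ X₀) :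
    (∀ G : α → ℝ, Measurable G → (∀ x, |G x| ≤ 1) →
      ((∫ x, G x ∂ν) - ∫ x, G x ∂μ) ^ 2 ≤ X₀ * ∫ x, (G x - ∫ z, G z ∂μ) ^ 2 ∂μ) ↔
    (ν ≪ μ ∧ ∫⁻ x, ENNReal.ofReal (((ν.rnDeriv μ x).toReal - 1) ^ 2) ∂μ ≤ ENNReal.ofReal X₀) :=
  ⟨fun h => ⟨absolutelyContinuous_of_dual_sq_le h, lintegral_rnDeriv_sub_one_sq_le_of_dual hX₀ h⟩,
    fun h _ hG hG1 => dual_sq_le_of_chiSq_le h.1 hX₀ h.2 hG hG1⟩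

end Summit.QuantumFields.YangMills.Theorems.ColdStartUniversality

end
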